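import Literature.AlgebraicGeometry.Resolution.RankOneReductionProofs
import Literature.AlgebraicGeometry.Resolution.QuasiExcellentSchemes
import Literature.AlgebraicGeometry.Resolution.ResolutionLU
import Literature.AlgebraicGeometry.Resolution.CofinalityFromPrincipalization
import Literature.AlgebraicGeometry.Resolution.ExcellentRingsEssFiniteType
import Literature.AlgebraicGeometry.Resolution.ExcellentClosedSubschemes
import Literature.AlgebraicGeometry.Resolution.LocalModels
import Literature.AlgebraicGeometry.Resolution.DimensionFormula
import Literature.AlgebraicGeometry.Resolution.ModelTransport
import Literature.AlgebraicGeometry.Resolution.ArithmeticalThreefoldsReduction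
import Literature.AlgebraicGeometry.Resolution.AffineModelLU
import Literature.AlgebraicGeometry.Resolution.ResidueAlgebraicTower
import Literature.AlgebraicGeometry.Resolution.ValuationRingsApproximation
import HarnessLib

/-!
# Cossart–Piltant 2019, Prop. 4.10: the reduction to rank-one valuations

Topic: `Literature/AlgebraicGeometry/Resolution` (proofs only: no new notions, no named facts).

In the proof of Prop. 4.10 (arXiv v1: Prop. 4.8) Cossart–Piltant reduce local uniformization
of a valuation `v` dominating a complete local domain of dimension three (residue field
algebraic) to the case of RANK-ONE valuations: "By [NSp] Theorem 1.1 or [CoP1]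
Proposition 5.1 it can be assumed that `v` has rank one; transcendental residue extensions
provide a reduction in `dim A` after blowing up" (v1 p. 53) — i.e. Novacoski–Spivakovsky's
reduction in the category of local domains essentially of finite type over a complete local
ring, whose inputs in dimension `≤ 2` are resolution of excellent surfaces. This file PROVES
that reduction in the climbing frame of `ArithmeticalThreefoldsReduction.lean`, conditional only
on the existing named fact `CossartJannsenSaito2020General` (resolution of reduced excellent
Noetherian schemes of dimension `≤ 2`): `rankOne_reduction_of_cjs` is hypothesis `hC5` of
`cossartPiltant2019ReductionP_of_parts` (`ArithmeticalThreefoldsLocalSeparableClimb.lean`).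

## The argument (no induction on the rank is needed in dimension three)

Let `S` be excellent regular local of dimension three, `E ⊇ S` algebraic, `O_E` a valuation
ring of `E` dominating `S` with residue field algebraic over `S/𝔪_S`, not of rank one. Then
`O_E ≠ E` and some valuation ring lies strictly between, `O_E < O₁' < E`
(`nonempty_rankOne_of_overrings`). At the level field `K = F(s₀) ⊆ E` (a subfield type) they
restrict to `O < O₁ < K` (`ValuationSubring.eq_of_le_of_comap_eq`; `O₁ ≠ K` because `E` is
integral over `K` and valuation rings are integrally closed). Pick `x ∈ 𝔪_O ∖ 𝔪_{O₁}` and a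
finitely generated model `R = S[g(s₀), x] ⊆ O` with `Frac R = K`. For every such model `A ∋ x`
with centres `Q ⊋ P ≠ 0` of `O`, `O₁`: `dim A_Q ≤ 3` (Matsumura Thm. 15.5,
`ringKrullDim_localization_le_of_isAlgebraic`), hence `dim A_P = ht P ≤ 2` and
`dim A_Q/P A_Q = ht(Q/P) ≤ 2` (`dims_of_separating_model`). So BOTH pieces of the composite
valuation live on excellent local domains of dimension `≤ 2`, where Cossart–Jannsen–Saito's
resolution and the valuative criterion (`exists_fg_regular_of_hasResolution`) provide regular
finitely generated models (`exists_fg_regular_of_cjs`, `exists_model_regular_of_cjs`,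
`exists_residueModel_regular_of_cjs`). Novacoski–Spivakovsky's three steps over the base ring
`S` (`RankOneReductionProofs.lean`, stated over a base ring: Cor. 2.14
`novacoskiSpivakovsky2014_cor214`, Cor. 2.17 `novacoskiSpivakovsky2014_cor217`, §3.1
`novacoskiSpivakovsky2014_step`) then give a finitely generated `A₃ ⊇ R` inside `O` regular at the centre
of `O` (`exists_model_regular_of_lt_of_cjs`), which is read back in `E`
(`ModelTransport.isRegularLocalRing_localization_map_iff`).

## Sources

* V. Cossart, O. Piltant, *Resolution of singularities of arithmetical threefolds*, J. Algebra
  529 (2019) 268–535 = arXiv:1412.0868, proof of Prop. 4.10 (v1: Prop. 4.8, p. 53).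
  [CossartPiltant2019]
* J. Novacoski, M. Spivakovsky, *Reduction of local uniformization to the rank one case*,
  EMS Ser. Congr. Rep. (2014), arXiv:1204.4751v1: Thm. 1.1, Cor. 2.14, Cor. 2.17, §3.1.
  [NovacoskiSpivakovsky2014]
* V. Cossart, U. Jannsen, S. Saito, *Desingularization: invariants and strategy*, LNM 2270
  (2020), Thm. 1.2. [CossartJannsenSaito2020]
* H. Matsumura, *Commutative Ring Theory*, Thm. 15.5. [Matsumura1987]
-/

noncomputable section

open CategoryTheory AlgebraicGeometry IsLocalRing Polynomial

namespace Literature.AlgebraicGeometry.Resolution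

universe u

/-! ## Resolution of excellent surfaces uniformizes valuations on local domains of dimension ≤ 2 -/

/-- **(LU) in dimension `≤ 2` from resolution of excellent surfaces** (Cossart–Jannsen–Saito
2020, Thm. 1.2, through the valuative criterion `exists_fg_regular_of_hasResolution`): for an
excellent Noetherian domain `D` of dimension `≤ 2` with fraction field `K` and a valuation ring
`O ⊇ D` of `K`, some finitely generated `D`-subalgebra `T ⊆ O` of `K` is regular at the centre
`𝔪_O ∩ T`. [cite: CossartJannsenSaito2020, Thm. 1.2] -/
theorem exists_fg_regular_of_cjs (hCJS : CossartJannsenSaito2020General.{u}) {D : Type u}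
    [CommRing D] [IsDomain D] [IsNoetherianRing D] (hexc : IsExcellentRing D)
    (hdim : ringKrullDim D ≤ 2) {K : Type u} [Field K] [Algebra D K] [IsFractionRing D K]
    (O : ValuationSubring K) (hDO : ∀ d : D, algebraMap D K d ∈ O) :
    ∃ (T : Subalgebra D K) (h : T.toSubring ≤ O.toSubring), T.FG ∧
      IsRegularLocalRing (Localization.AtPrime
        (Ideal.comap (Subring.inclusion h) (maximalIdeal O))) := by
  haveI : IsDomain (CommRingCat.of D) := ‹IsDomain D›
  haveI : IsNoetherianRing (CommRingCat.of D) := ‹IsNoetherianRing D›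
  have hexcS : Scheme.IsExcellent (Spec (.of D)) := Scheme.isExcellent_Spec_of_isExcellentRing D hexc
  have hdimS : topologicalKrullDim (Spec (.of D)) ≤ 2 := by
    change topologicalKrullDim (PrimeSpectrum D) ≤ 2
    rw [PrimeSpectrum.topologicalKrullDim_eq_ringKrullDim]
    exact hdim
  obtain ⟨X', π, hπ, -⟩ := hCJS (Spec (.of D)) hexcS hdimS
  exact exists_fg_regular_of_hasResolution O hDO ⟨X', π, hπ⟩

/-! ## A regular model above a given model whose local ring at the centre has dimension ≤ 2 -/

section ModelOfDimLeTwo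

variable {k K : Type u} [CommRing k] [Field K] [Algebra k K]

/-- **Regular models in dimension `≤ 2`**: let `R ⊆ O'` be a finitely generated `k`-subalgebra of
the field `K = Frac R` inside a valuation ring `O'`, with centre `P' = 𝔪_{O'} ∩ R`. If `R_{P'}`
is excellent of dimension `≤ 2`, then some finitely generated `A₁ ⊇ R` inside `O'` is regular at
the centre of `O'`: resolve `Spec R_{P'}` (Cossart–Jannsen–Saito, `exists_fg_regular_of_cjs`),
read off a regular finitely generated `R_{P'}`-model `T = R_{P'}[g] ⊆ O'`, and take
`A₁ = R[g]`, which has the same local ring at the centre of `O'` as `T`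
(Novacoski–Spivakovsky, Lemma 2.5 (1)). [cite: CossartJannsenSaito2020, Thm. 1.2]
[cite: NovacoskiSpivakovsky2014, Lemma 2.5 (1)] -/
theorem exists_model_regular_of_cjs (hCJS : CossartJannsenSaito2020General.{u})
    (O' : ValuationSubring K) (R : Subalgebra k K) (hRfg : R.FG) [IsNoetherianRing R]
    [IsFractionRing R K] (hRO : R.toSubring ≤ O'.toSubring)
    (P' : Ideal R) [P'.IsPrime] (hP' : ∀ z : R, z ∈ P' ↔ O'.valuation (z : K) < 1)
    (hexc : IsExcellentRing (Localization.AtPrime P'))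
    (hdim : ringKrullDim (Localization.AtPrime P') ≤ 2) :
    ∃ (A₁ : Subalgebra k K) (hA₁ : A₁.toSubring ≤ O'.toSubring), R ≤ A₁ ∧ A₁.FG ∧
      IsRegularLocalRing
        (Localization.AtPrime ((maximalIdeal O').comap (Subring.inclusion hA₁))) := by
  classical
  -- the local ring `D = R_{P'}` realised inside `K`
  let D : Subalgebra R K :=
    Localization.subalgebra.ofField K P'.primeCompl P'.primeCompl_le_nonZeroDivisors
  haveI : IsLocalization.AtPrime D P' :=
    Localization.subalgebra.isLocalization_ofField K P'.primeCompl P'.primeCompl_le_nonZeroDivisors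
  let e : Localization.AtPrime P' ≃ₐ[R] D :=
    IsLocalization.algEquiv P'.primeCompl (Localization.AtPrime P') D
  haveI : IsNoetherianRing D := isNoetherianRing_of_ringEquiv _ e.toRingEquiv
  have hexcD : IsExcellentRing D := IsExcellentRing.of_ringEquiv e.toRingEquiv hexc
  have hdimD : ringKrullDim D ≤ 2 := by
    rw [← ringKrullDim_eq_of_ringEquiv e.toRingEquiv]; exact hdim
  haveI : IsFractionRing D K :=
    IsFractionRing.isFractionRing_of_isDomain_of_isLocalization P'.primeCompl D K
  have hmemD : ∀ x : K, x ∈ D ↔ ∃ a : R, ∃ s : R, s ∉ P' ∧ x = (a : K) * ((s : K))⁻¹ := by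
    intro x
    change (∃ (a s : R) (_ : s ∈ P'.primeCompl),
      x = algebraMap R K a * (algebraMap R K s)⁻¹) ↔ _
    constructor
    · rintro ⟨a, s, hs, rfl⟩; exact ⟨a, s, hs, rfl⟩
    · rintro ⟨a, s, hs, rfl⟩; exact ⟨a, s, hs, rfl⟩
  have hunit : ∀ s : R, s ∉ P' → O'.valuation (s : K) = 1 := fun s hs => by
    have hle : O'.valuation (s : K) ≤ 1 := (O'.valuation_le_one_iff _).mpr (hRO s.2)
    exact le_antisymm hle (not_lt.mp fun hlt => hs ((hP' s).mpr hlt))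
  have hDO : ∀ d : D, algebraMap D K d ∈ O' := by
    intro d
    obtain ⟨a, s, hs, hd⟩ := (hmemD d).mp d.2
    change (d : K) ∈ O'
    rw [hd]
    refine mul_mem (hRO a.2) ?_
    rw [← O'.valuation_le_one_iff, map_inv₀, hunit s hs, inv_one]
  -- a regular finitely generated model over `D`
  obtain ⟨T, hT, hTfg, hTreg⟩ := exists_fg_regular_of_cjs hCJS hexcD hdimD O' hDO
  obtain ⟨g, hg⟩ := hTfg
  -- the model `A₁ = R[g]`
  have hRT : ∀ z : K, z ∈ R → z ∈ T := fun z hz => by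
    have hzD : z ∈ D := (hmemD z).mpr ⟨⟨z, hz⟩, 1, fun h1 => by
      have := (hP' 1).mp h1
      simp at this, by simp⟩
    exact T.algebraMap_mem (⟨z, hzD⟩ : D)
  have hk : ∀ c : k, algebraMap k K c ∈ T := fun c => hRT _ (R.algebraMap_mem c)
  let Tk : Subalgebra k K := { T.toSubring with algebraMap_mem' := hk }
  have hTk : Tk.toSubring ≤ O'.toSubring := fun z hz => hT hz
  let A₁ : Subalgebra k K := R ⊔ Algebra.adjoin k (g : Set K)
  have hgT : ∀ z ∈ (g : Set K), z ∈ T := fun z hz => by rw [← hg]; exact Algebra.subset_adjoin hz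
  have hA₁Tk : A₁ ≤ Tk := sup_le (fun z hz => hRT z hz) (Algebra.adjoin_le fun z hz => hgT z hz)
  have hA₁O : A₁.toSubring ≤ O'.toSubring := fun z hz => hT (hA₁Tk hz)
  have hRA₁ : R ≤ A₁ := le_sup_left
  refine ⟨A₁, hA₁O, hRA₁, hRfg.sup ⟨g, rfl⟩, ?_⟩
  haveI : IsFractionRing R.toSubring K := ‹IsFractionRing R K›
  haveI : IsFractionRing A₁.toSubring K := isFractionRing_subalgebra_of_le R A₁ hRA₁
  haveI : IsFractionRing Tk.toSubring K :=
    isFractionRing_subalgebra_of_le R Tk (hRA₁.trans hA₁Tk)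
  -- `T ⊆ L(A₁)`: `D ⊆ L(R) ⊆ L(A₁)` and `g ⊆ A₁`
  have h1 : (Tk : Set K) ⊆ (Localization.subalgebra.ofField K
      ((maximalIdeal O').comap (Subring.inclusion hA₁O)).primeCompl
      (Ideal.primeCompl_le_nonZeroDivisors _)) := by
    have hD : (D : Set K) ⊆ (Localization.subalgebra.ofField K
        ((maximalIdeal O').comap (Subring.inclusion hA₁O)).primeCompl
        (Ideal.primeCompl_le_nonZeroDivisors _)) := by
      intro z hz
      obtain ⟨a, s, hs, rfl⟩ := (hmemD z).mp hz
      rw [SetLike.mem_coe, mem_centreLocalization_iff]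
      exact ⟨a, hRA₁ a.2, s, hRA₁ s.2, hunit s hs, rfl⟩
    have hTcl : T.toSubring = Subring.closure (Set.range (algebraMap D K) ∪ (g : Set K)) := by
      rw [← hg]; exact Algebra.adjoin_eq_ring_closure _
    intro z hz
    have hz' : z ∈ T.toSubring := hz
    rw [hTcl] at hz'
    have hsub : Set.range (algebraMap D K) ∪ (g : Set K) ⊆ ((Localization.subalgebra.ofField K
        ((maximalIdeal O').comap (Subring.inclusion hA₁O)).primeCompl
        (Ideal.primeCompl_le_nonZeroDivisors _)).toSubring : Set K) := by
      rintro w (⟨d, rfl⟩ | hw)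
      · exact hD d.2
      · exact le_centreLocalization O' A₁ hA₁O
          ((le_sup_right : Algebra.adjoin k (g : Set K) ≤ A₁) (Algebra.subset_adjoin hw))
    exact Subring.closure_le.mpr hsub hz'
  have h2 : (A₁ : Set K) ⊆ (Localization.subalgebra.ofField K
      ((maximalIdeal O').comap (Subring.inclusion hTk)).primeCompl
      (Ideal.primeCompl_le_nonZeroDivisors _)) :=
    fun z hz => le_centreLocalization O' Tk hTk (hA₁Tk hz)
  have heq : ((Localization.subalgebra.ofField K
      ((maximalIdeal O').comap (Subring.inclusion hA₁O)).primeCompl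
      (Ideal.primeCompl_le_nonZeroDivisors _)) : Set K)
      = (Localization.subalgebra.ofField K
      ((maximalIdeal O').comap (Subring.inclusion hTk)).primeCompl
      (Ideal.primeCompl_le_nonZeroDivisors _)) :=
    le_antisymm (centreLocalization_le O' A₁ Tk hA₁O hTk h2)
      (centreLocalization_le O' Tk A₁ hTk hA₁O h1)
  exact isRegularLocalRing_of_centreLocalization_eq O' A₁ Tk hA₁O hTk heq hTreg

end ModelOfDimLeTwo



/-! ## Dimension bookkeeping on a model separating `O` from a proper overring `O₁` -/

section Dims

variable {S K : Type u} [CommRing S] [IsDomain S] [IsLocalRing S] [IsNoetherianRing S]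
  [Field K] [Algebra S K] [FaithfulSMul S K] [Algebra.IsAlgebraic S K]

/-- **The two pieces of a composite valuation in dimension three have dimension `≤ 2`.** Let `S`
be a Noetherian local domain of dimension three, `K ⊇ S` algebraic, `O ≤ O₁ ≠ K` valuation rings
of `K` with `O` dominating `S` and residue field algebraic over that of `S`, and `A ⊆ O` a finitely
generated model with `Frac A = K` containing an element `x` of `𝔪_O ∖ 𝔪_{O₁}`; `Q ⊇ P` the
centres of `O`, `O₁` on `A`. Then `dim A_Q ≤ 3` (Matsumura Thm. 15.5), `0 ≠ P ⊊ Q`, hence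
`dim A_P = ht P ≤ 2` and `dim A_Q / P A_Q = ht (Q/P) ≤ 2` (`ht P + ht (Q/P) ≤ ht Q`).
[cite: Matsumura1987, Thm. 15.5] [cite: NovacoskiSpivakovsky2014, §3.1] -/
theorem dims_of_separating_model (hSdim : ringKrullDim S = 3)
    (O O₁ : ValuationSubring K) (hO : O ≤ O₁) (hO₁ : O₁ ≠ ⊤)
    (hSO : ∀ s : S, algebraMap S K s ∈ O)
    (hdom : ∀ s ∈ maximalIdeal S, O.valuation (algebraMap S K s) < 1)
    (hres : ∀ y : O, ∃ q : S[X], (∃ i, q.coeff i ∉ maximalIdeal S) ∧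
      O.valuation (q.eval₂ (algebraMap S K) y) < 1)
    (A : Subalgebra S K) (hAfg : A.FG) [IsFractionRing A K] (hA : A.toSubring ≤ O.toSubring)
    (x : K) (hxA : x ∈ A) (hxO : O.valuation x < 1) (hxO₁ : O₁.valuation x = 1)
    (Q P : Ideal A) [Q.IsPrime] [P.IsPrime]
    (hQ : ∀ z : A, z ∈ Q ↔ O.valuation (z : K) < 1)
    (hP : ∀ z : A, z ∈ P ↔ O₁.valuation (z : K) < 1) :
    P ≤ Q ∧ ringKrullDim (Localization.AtPrime P) ≤ 2 ∧
      (Q.map (Ideal.Quotient.mk P)).height ≤ 2 := by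
  classical
  haveI : FaithfulSMul S A := (faithfulSMul_iff_algebraMap_injective S A).mpr fun a b hab =>
    FaithfulSMul.algebraMap_injective S K (by
      have h1 := congrArg (fun z : A => (z : K)) hab
      rw [IsScalarTower.algebraMap_apply S A K a, IsScalarTower.algebraMap_apply S A K b]
      exact h1)
  haveI : Algebra.FiniteType S A := (Subalgebra.fg_iff_finiteType _).mp hAfg
  haveI : IsNoetherianRing A := Algebra.FiniteType.isNoetherianRing S A
  haveI : Algebra.IsAlgebraic S A :=
    Algebra.IsAlgebraic.of_injective A.val Subtype.val_injective
  have hAO : ∀ z : A, (z : K) ∈ O := fun z => hA z.2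
  haveI := liesOver_maximalIdeal_of_forall_valuation_lt_one O hSO hdom A Q hQ
  haveI := isAlgebraic_quotient_of_forall_valuation_lt_one O hres A hAO Q hQ
  -- `dim A_Q ≤ 3`
  have hdimQ : ringKrullDim (Localization.AtPrime Q) ≤ 3 := by
    rw [← hSdim]; exact ringKrullDim_localization_le_of_isAlgebraic Q
  -- `P ≤ Q`, `P ≠ Q`
  have hPQ : P ≤ Q := by
    intro z hz
    rw [hP] at hz
    rw [hQ]
    by_contra hnot
    have hz0 : (z : K) ≠ 0 := fun h0 => hnot (by rw [h0, map_zero]; exact zero_lt_one)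
    have hz1 : O.valuation (z : K) = 1 :=
      le_antisymm ((O.valuation_le_one_iff _).mpr (hAO z)) (not_lt.mp hnot)
    have hzinv : (z : K)⁻¹ ∈ O := by rw [← O.valuation_le_one_iff, map_inv₀, hz1, inv_one]
    have h1 : O₁.valuation ((z : K)⁻¹) ≤ 1 := (O₁.valuation_le_one_iff _).mpr (hO hzinv)
    have h2 : O₁.valuation ((z : K) * (z : K)⁻¹) < 1 := by
      rw [map_mul]
      calc O₁.valuation (z : K) * O₁.valuation ((z : K)⁻¹)
          ≤ O₁.valuation (z : K) * 1 := by gcongr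
        _ = O₁.valuation (z : K) := mul_one _
        _ < 1 := hz
    rw [mul_inv_cancel₀ hz0, map_one] at h2
    exact lt_irrefl _ h2
  have hxQ : (⟨x, hxA⟩ : A) ∈ Q := (hQ _).mpr hxO
  have hxP : (⟨x, hxA⟩ : A) ∉ P := fun h => by
    have := (hP _).mp h
    rw [hxO₁] at this
    exact lt_irrefl _ this
  have hlt : P < Q := lt_of_le_of_ne hPQ fun h => hxP (h ▸ hxQ)
  -- `P ≠ 0`
  have hPbot : (⊥ : Ideal A) < P := by
    rw [bot_lt_iff_ne_bot]
    intro hP0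
    apply hO₁
    ext z
    simp only [ValuationSubring.mem_top, iff_true]
    obtain ⟨a, b, hb, rfl⟩ := IsFractionRing.div_surjective (A := A) z
    have hb0 : b ≠ 0 := nonZeroDivisors.ne_zero hb
    have hbP : b ∉ P := by rw [hP0]; exact hb0
    have hb1 : O₁.valuation (b : K) = 1 :=
      le_antisymm ((O₁.valuation_le_one_iff _).mpr (hO (hAO b)))
        (not_lt.mp fun hlt' => hbP ((hP b).mpr hlt'))
    change (a : K) / (b : K) ∈ O₁
    rw [div_eq_mul_inv]
    refine mul_mem (hO (hAO a)) ?_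
    rw [← O₁.valuation_le_one_iff, map_inv₀, hb1, inv_one]
  -- heights
  haveI hQ' : (Q.map (Ideal.Quotient.mk P)).IsPrime :=
    Ideal.map_isPrime_of_surjective Ideal.Quotient.mk_surjective (by rwa [Ideal.mk_ker])
  obtain ⟨a, ha⟩ := ENat.ne_top_iff_exists.mp (Ideal.height_ne_top_of_isPrime (I := P))
  obtain ⟨b, hb⟩ := ENat.ne_top_iff_exists.mp (Ideal.height_ne_top_of_isPrime (I := Q))
  obtain ⟨c, hc⟩ := ENat.ne_top_iff_exists.mp
    (Ideal.height_ne_top_of_isPrime (I := Q.map (Ideal.Quotient.mk P)))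
  have h01 : (⊥ : Ideal A).height < P.height := Ideal.height_strict_mono_of_isPrime hPbot
  have h12 : P.height < Q.height := Ideal.height_strict_mono_of_isPrime hlt
  have h3 : Q.height ≤ 3 := by
    have h := hdimQ
    rw [IsLocalization.AtPrime.ringKrullDim_eq_height Q (Localization.AtPrime Q)] at h
    exact WithBot.coe_le_coe.mp h
  have hsum := add_le_height_of_le P Q hPQ a c ha.le hc.le
  rw [Ideal.height_bot, ← ha] at h01
  rw [← ha, ← hb] at h12
  rw [← hb] at h3 hsum
  have h01' : 0 < a := by exact_mod_cast h01
  have h12' : a < b := by exact_mod_cast h12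
  have h3' : b ≤ 3 := by exact_mod_cast h3
  have hsum' : a + c ≤ b := by exact_mod_cast hsum
  refine ⟨hPQ, ?_, ?_⟩
  · rw [IsLocalization.AtPrime.ringKrullDim_eq_height P (Localization.AtPrime P), ← ha]
    exact WithBot.coe_le_coe.mpr (by exact_mod_cast (by omega : a ≤ 2))
  · rw [← hc]
    exact_mod_cast (by omega : c ≤ 2)

end Dims

/-! ## The residue side: a regular model of `ν₂` above `φ(A) ≅ A / p` -/

section Residue

variable {S K : Type u} [CommRing S] [Field K] [Algebra S K]

/-- **Local uniformization of `ν₂` above the residue model** — the input `h₂` of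
`novacoskiSpivakovsky2014_cor217`, discharged by resolution of excellent surfaces: with `A ⊆ O ≤ O₁` a finitely
generated model over the excellent ring `S`, `Q ⊇ P` the centres, `φ : A → κ ⊆ κ(O₁)` the
residue map (so `φ(A) ≅ A/P`, an excellent domain), and `ht (Q/P) ≤ 2`, the local ring of `φ(A)`
at the centre of `ν₂` is excellent of dimension `≤ 2`, and `exists_model_regular_of_cjs` gives
a regular finitely generated model `B ⊇ φ(A)` of `ν₂` restricted to `κ = Frac φ(A)`.
[cite: CossartJannsenSaito2020, Thm. 1.2] [cite: NovacoskiSpivakovsky2014, Cor. 2.17] -/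
theorem exists_residueModel_regular_of_cjs (hCJS : CossartJannsenSaito2020General.{u})
    (hS : IsExcellentRing S) (O O₁ : ValuationSubring K) (hO : O ≤ O₁) (A : Subalgebra S K)
    (hA : A.toSubring ≤ O.toSubring) (hAfg : A.FG) (Q P : Ideal A) [Q.IsPrime] [P.IsPrime]
    (hQ : ∀ z : A, z ∈ Q ↔ O.valuation (z : K) < 1)
    (hP : ∀ z : A, z ∈ P ↔ O₁.valuation (z : K) < 1) (hPQ : P ≤ Q)
    (hdimQP : (Q.map (Ideal.Quotient.mk P)).height ≤ 2)
    (κ : Type u) [Field κ] [Algebra S κ] (ι : κ →+* ResidueField O₁) (φ : A →ₐ[S] κ)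
    (hφ : ∀ a : A, ι (φ a) = residue O₁ ⟨(a : K), (hA.trans hO) a.2⟩)
    (hfr : IsFractionRing φ.range κ) :
    ∃ (B : Subalgebra S κ)
      (hB : B.toSubring ≤ ((residueValuationSubring O O₁ hO).comap ι).toSubring),
      φ.range ≤ B ∧ B.FG ∧
      IsRegularLocalRing (Localization.AtPrime
        ((maximalIdeal ((residueValuationSubring O O₁ hO).comap ι)).comap
          (Subring.inclusion hB))) := by
  classical
  haveI : IsNoetherianRing S := hS.isUniversallyCatenaryRing.1
  let O₂ := residueValuationSubring O O₁ hO
  let O₂' := O₂.comap ι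
  have hO₂' : ∀ y : κ, O₂'.valuation y < 1 ↔ O₂.valuation (ι y) < 1 := fun y =>
    valuation_comap_lt_one_iff O₂ ι y
  let B₀ : Subalgebra S κ := φ.range
  have hB₀fg : B₀.FG := by
    have h := ((Subalgebra.fg_top A).mpr hAfg).map φ
    rwa [Algebra.map_top] at h
  haveI : IsNoetherianRing B₀ := isNoetherianRing_of_fg hB₀fg
  haveI : Algebra.FiniteType S B₀ := (Subalgebra.fg_iff_finiteType _).mp hB₀fg
  haveI : IsFractionRing B₀ κ := hfr
  have hB₀O : B₀.toSubring ≤ O₂'.toSubring := by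
    intro z hz
    obtain ⟨a, rfl⟩ := (AlgHom.mem_range φ).mp (show z ∈ φ.range from hz)
    change φ a ∈ O₂.comap ι
    rw [ValuationSubring.mem_comap, hφ]
    exact (residue_mem_residueValuationSubring_iff O O₁ hO _).mpr (hA a.2)
  let 𝔮 : Ideal B₀ := (maximalIdeal O₂').comap (Subring.inclusion hB₀O)
  haveI : 𝔮.IsPrime := Ideal.IsPrime.comap _
  have h𝔮 : ∀ z : B₀, z ∈ 𝔮 ↔ O₂'.valuation (z : κ) < 1 := fun z => by
    rw [Ideal.mem_comap, ValuationSubring.valuation_lt_one_iff]; rfl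
  have hexc𝔮 : IsExcellentRing (Localization.AtPrime 𝔮) := isExcellentRing_localization_atPrime hS 𝔮
  -- `φ(A) ≅ A / P`, carrying the centre of `ν₂` to `Q / P`
  let ψ : A →ₐ[S] B₀ := φ.rangeRestrict
  have hψ : Function.Surjective ψ := AlgHom.rangeRestrict_surjective φ
  have hψval : ∀ a : A, ((ψ a : B₀) : κ) = φ a := fun a => rfl
  have hker : RingHom.ker ψ.toRingHom = P := by
    ext a
    rw [RingHom.mem_ker, hP]
    change ψ a = 0 ↔ _
    rw [Subtype.ext_iff, hψval, ZeroMemClass.coe_zero, ← map_eq_zero_iff ι ι.injective, hφ,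
      residue_eq_zero_iff, ValuationSubring.valuation_lt_one_iff]
  have hψ' : Function.Surjective ψ.toRingHom := hψ
  let e : (A ⧸ P) ≃+* B₀ :=
    (Ideal.quotEquivOfEq hker.symm).trans (RingHom.quotientKerEquivOfSurjective hψ')
  have he : ∀ a : A, e (Ideal.Quotient.mk P a) = ψ a := fun a => by
    change (RingHom.quotientKerEquivOfSurjective hψ')
      (Ideal.quotEquivOfEq hker.symm (Ideal.Quotient.mk P a)) = ψ a
    rw [Ideal.quotEquivOfEq_mk, RingHom.quotientKerEquivOfSurjective_apply_mk]
    rfl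
  haveI hQ' : (Q.map (Ideal.Quotient.mk P)).IsPrime :=
    Ideal.map_isPrime_of_surjective Ideal.Quotient.mk_surjective (by rwa [Ideal.mk_ker])
  have hcomap : 𝔮.comap e = Q.map (Ideal.Quotient.mk P) := by
    ext z
    obtain ⟨a, rfl⟩ := Ideal.Quotient.mk_surjective z
    rw [Ideal.mem_quotient_iff_mem hPQ, Ideal.mem_comap, hQ]
    rw [he, h𝔮, hψval, hO₂', hφ, ← valuation_lt_one_iff_residue O O₁ hO (a : K) (hA a.2)]
  have hheight : 𝔮.height = (Q.map (Ideal.Quotient.mk P)).height := by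
    rw [← hcomap]; exact (RingEquiv.height_comap e 𝔮).symm
  have hdim𝔮 : ringKrullDim (Localization.AtPrime 𝔮) ≤ 2 := by
    rw [IsLocalization.AtPrime.ringKrullDim_eq_height 𝔮 (Localization.AtPrime 𝔮), hheight]
    exact WithBot.coe_le_coe.mpr hdimQP
  exact exists_model_regular_of_cjs hCJS O₂' B₀ hB₀fg hB₀O 𝔮 h𝔮 hexc𝔮 hdim𝔮

end Residue

/-! ## The three steps over the base `S`, at a fixed level field `K` -/

section Core

variable {S K : Type u} [CommRing S] [IsDomain S] [IsLocalRing S]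
  [Field K] [Algebra S K] [FaithfulSMul S K] [Algebra.IsAlgebraic S K]

/-- **Regular models for composite valuations in dimension three** (Cossart–Piltant 2019,
proof of Prop. 4.10, "it can be assumed that `v` has rank one … transcendental residue
extensions provide a reduction in `dim A` after blowing up", via Novacoski–Spivakovsky's §3.1
with both inputs supplied by resolution of excellent surfaces). Let `S` be an excellent local
domain of dimension three, `K ⊇ S` algebraic, `O < O₁ < K` valuation rings with `O`
dominating `S` and residue field algebraic over that of `S`, and `R ⊆ O` a finitely generated
model with `Frac R = K`. Then some finitely generated `A ⊇ R` inside `O` is regular at the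
centre of `O`: adjoin `x ∈ 𝔪_O ∖ 𝔪_{O₁}`; `dims_of_separating_model` bounds the two
dimensions by `2`; `exists_model_regular_of_cjs` uniformizes `ν₁ = ν_{O₁}` (Cor. 2.14,
`novacoskiSpivakovsky2014_cor214`), `exists_residueModel_regular_of_cjs` uniformizes `ν₂` above the residue
model (Cor. 2.17, `novacoskiSpivakovsky2014_cor217`), and the final blowing up of §3.1 (`novacoskiSpivakovsky2014_step`)
concludes. [cite: CossartPiltant2019, proof of Prop. 4.10 (arXiv v1: Prop. 4.8, p. 53)]
[cite: NovacoskiSpivakovsky2014, §3.1] [cite: CossartJannsenSaito2020, Thm. 1.2] -/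
theorem exists_model_regular_of_lt_of_cjs (hCJS : CossartJannsenSaito2020General.{u})
    (hS : IsExcellentRing S) (hSdim : ringKrullDim S = 3)
    (O O₁ : ValuationSubring K) (hO : O ≤ O₁) (hne : O ≠ O₁) (hO₁ : O₁ ≠ ⊤)
    (hSO : ∀ s : S, algebraMap S K s ∈ O)
    (hdom : ∀ s ∈ maximalIdeal S, O.valuation (algebraMap S K s) < 1)
    (hres : ∀ y : O, ∃ q : S[X], (∃ i, q.coeff i ∉ maximalIdeal S) ∧
      O.valuation (q.eval₂ (algebraMap S K) y) < 1)
    (R : Subalgebra S K) (hRfg : R.FG) [hRfrac : IsFractionRing R K]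
    (hRO : R.toSubring ≤ O.toSubring) :
    ∃ (A : Subalgebra S K) (hA : A.toSubring ≤ O.toSubring), R ≤ A ∧ A.FG ∧
      IsRegularLocalRing (Localization.AtPrime ((maximalIdeal O).comap (Subring.inclusion hA))) := by
  classical
  haveI : IsNoetherianRing S := hS.isUniversallyCatenaryRing.1
  -- an element `x ∈ 𝔪_O ∖ 𝔪_{O₁}`
  obtain ⟨y, hyO₁, hyO⟩ : ∃ y : K, y ∈ O₁ ∧ y ∉ O := by
    by_contra h
    push Not at h
    exact hne (le_antisymm hO fun z hz => h z hz)
  have hy0 : y ≠ 0 := fun h0 => hyO (by rw [h0]; exact O.zero_mem)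
  set x : K := y⁻¹ with hxdef
  have hx0 : x ≠ 0 := inv_ne_zero hy0
  have hxO : x ∈ O := (O.mem_or_inv_mem y).resolve_left hyO
  have hxv : O.valuation x < 1 := by
    change O.valuation ((⟨x, hxO⟩ : O) : K) < 1
    rw [← ValuationSubring.valuation_lt_one_iff, mem_maximalIdeal, mem_nonunits_iff]
    intro hu
    apply hyO
    have := inv_mem_of_isUnit O hxO hu
    rwa [hxdef, inv_inv] at this
  have hxv₁ : O₁.valuation x = 1 := by
    apply le_antisymm ((O₁.valuation_le_one_iff x).mpr (hO hxO))
    have h := (O₁.valuation_le_one_iff x⁻¹).mpr (by rw [hxdef, inv_inv]; exact hyO₁)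
    rwa [map_inv₀, inv_le_one₀ ((Valuation.pos_iff _).mpr hx0)] at h
  -- the model `R' = R[x]`
  let R' : Subalgebra S K := R ⊔ Algebra.adjoin S {x}
  have hRR' : R ≤ R' := le_sup_left
  have hR'fg : R'.FG := hRfg.sup ⟨{x}, by rw [Finset.coe_singleton]⟩
  have hR'O : R'.toSubring ≤ O.toSubring := by
    have : R' ≤ ({ O.toSubring with algebraMap_mem' := hSO } : Subalgebra S K) :=
      sup_le (fun z hz => hRO hz) (Algebra.adjoin_le (Set.singleton_subset_iff.mpr hxO))
    exact fun z hz => this hz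
  have hR'O₁ : R'.toSubring ≤ O₁.toSubring := hR'O.trans hO
  haveI : IsFractionRing R.toSubring K := hRfrac
  haveI hR'frac : IsFractionRing R'.toSubring K := isFractionRing_subalgebra_of_le R R' hRR'
  haveI hR'frac' : IsFractionRing R' K := hR'frac
  have hxR' : x ∈ R' :=
    (le_sup_right : Algebra.adjoin S {x} ≤ R') (Algebra.subset_adjoin (Set.mem_singleton x))
  haveI : IsNoetherianRing R' := isNoetherianRing_of_fg hR'fg
  haveI : Algebra.FiniteType S R' := (Subalgebra.fg_iff_finiteType _).mp hR'fg
  -- the centres on `R'`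
  let Q : Ideal R' := (maximalIdeal O).comap (Subring.inclusion hR'O)
  let P : Ideal R' := (maximalIdeal O₁).comap (Subring.inclusion hR'O₁)
  haveI : Q.IsPrime := Ideal.IsPrime.comap _
  haveI : P.IsPrime := Ideal.IsPrime.comap _
  have hQ : ∀ z : R', z ∈ Q ↔ O.valuation (z : K) < 1 := fun z => by
    rw [Ideal.mem_comap, ValuationSubring.valuation_lt_one_iff]; rfl
  have hP : ∀ z : R', z ∈ P ↔ O₁.valuation (z : K) < 1 := fun z => by
    rw [Ideal.mem_comap, ValuationSubring.valuation_lt_one_iff]; rfl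
  obtain ⟨-, hdimP, -⟩ := dims_of_separating_model hSdim O O₁ hO hO₁ hSO hdom hres R' hR'fg hR'O
    x hxR' hxv hxv₁ Q P hQ hP
  have hexcP : IsExcellentRing (Localization.AtPrime P) := isExcellentRing_localization_atPrime hS P
  -- Cor. 2.14: a model regular at the centre of `ν₁`
  have h₁ := exists_model_regular_of_cjs hCJS O₁ R' hR'fg hR'O₁ P hP hexcP hdimP
  obtain ⟨A, hA, hR'A, hAfg, hregPA⟩ := novacoskiSpivakovsky2014_cor214 O O₁ hO R' hR'fg hR'frac' hR'O h₁
  -- Cor. 2.17 on `A`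
  haveI hAfrac : IsFractionRing A.toSubring K := isFractionRing_subalgebra_of_le R' A hR'A
  haveI hAfrac' : IsFractionRing A K := hAfrac
  have hAO₁ : A.toSubring ≤ O₁.toSubring := hA.trans hO
  let QA : Ideal A := (maximalIdeal O).comap (Subring.inclusion hA)
  let PA : Ideal A := (maximalIdeal O₁).comap (Subring.inclusion hAO₁)
  haveI : QA.IsPrime := Ideal.IsPrime.comap _
  haveI : PA.IsPrime := Ideal.IsPrime.comap _
  have hQA : ∀ z : A, z ∈ QA ↔ O.valuation (z : K) < 1 := fun z => by
    rw [Ideal.mem_comap, ValuationSubring.valuation_lt_one_iff]; rfl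
  have hPA : ∀ z : A, z ∈ PA ↔ O₁.valuation (z : K) < 1 := fun z => by
    rw [Ideal.mem_comap, ValuationSubring.valuation_lt_one_iff]; rfl
  obtain ⟨hPQA, -, hdimQPA⟩ := dims_of_separating_model hSdim O O₁ hO hO₁ hSO hdom hres A hAfg hA
    x (hR'A hxR') hxv hxv₁ QA PA hQA hPA
  have h₂ := exists_residueModel_regular_of_cjs hCJS hS O O₁ hO A hA hAfg QA PA hQA hPA hPQA
    hdimQPA
  obtain ⟨A₂, hA₂, hAA₂, hA₂fg, hregP₂, hregQ₂⟩ :=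
    novacoskiSpivakovsky2014_cor217 O O₁ hO A hA hAfg hAfrac' hregPA h₂
  -- §3.1, final step
  haveI hA₂frac : IsFractionRing A₂.toSubring K :=
    isFractionRing_subalgebra_of_le A A₂ hAA₂
  obtain ⟨A₃, hA₃, hA₂₃, hA₃fg, hreg₃⟩ :=
    novacoskiSpivakovsky2014_step O O₁ hO A₂ hA₂ hA₂fg hA₂frac hregP₂ hregQ₂
  exact ⟨A₃, hA₃, hRR'.trans (hR'A.trans (hAA₂.trans hA₂₃)), hA₃fg, hreg₃⟩

end Core

/-! ## The reduction to rank one in Cossart–Piltant's frame -/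

/-- **Cossart–Piltant 2019, Prop. 4.10, the reduction to rank-one valuations** ("By [NSp]
Theorem 1.1 or [CoP1] Proposition 5.1 it can be assumed that `v` has rank one; transcendental
residue extensions provide a reduction in `dim A` after blowing up"), from resolution of
excellent surfaces (`CossartJannsenSaito2020General`): in the climbing frame — `S` an excellent
regular local domain of dimension three, `E ⊇ S` an algebraic (algebraically closed) field,
valuation rings `O_E` of `E` dominating `S` with residue field algebraic over that of `S`,
local uniformization by finitely generated models `S[t]` — local uniformization for the
RANK-ONE such `O_E` implies it for all of them. For `O_E` not of rank one there is
`O_E < O₁ < E` (`nonempty_rankOne_of_overrings`); at the level field `K = F(s₀)` the two rings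
restrict to `O < O₁ < K` (`eq_of_le_of_comap_eq`; valuation rings are integrally closed), and
`exists_model_regular_of_lt_of_cjs` produces the regular model, read back in `E` along `K ⊆ E`
(`ModelTransport.lean`). This is hypothesis `hC5` of `cossartPiltant2019ReductionP_of_parts`
(up to its redundant `[IsDomain S]` binder), now conditional only on resolution of excellent
surfaces.
[cite: CossartPiltant2019, proof of Prop. 4.10 (arXiv v1: Prop. 4.8, p. 53)]
[cite: NovacoskiSpivakovsky2014, Thm. 1.1] [cite: CossartJannsenSaito2020, Thm. 1.2] -/
theorem rankOne_reduction_of_cjs (hCJS : CossartJannsenSaito2020General.{u}) :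
    ∀ (p : ℕ), p.Prime →
    ∀ (S : Type u) [CommRing S] [IsRegularLocalRing S],
      IsExcellentRing S → ringKrullDim S = 3 → CharP (ResidueField S) p →
      IsAdicComplete (maximalIdeal S) S →
    ∀ (E : Type u) [Field E] [Algebra S E], Function.Injective (algebraMap S E) →
      IsAlgClosed E → Algebra.IsAlgebraic S E →
    (∀ (OE : ValuationSubring E), Nonempty OE.valuation.RankOne →
      (∀ s : S, algebraMap S E s ∈ OE) →
      (∀ s ∈ maximalIdeal S, OE.valuation (algebraMap S E s) < 1) →
      (∀ y : OE, ∃ q : S[X], (∃ i, q.coeff i ∉ maximalIdeal S) ∧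
        OE.valuation (q.eval₂ (algebraMap S E) y) < 1) →
      ∀ s₀ : Finset E, ∃ t : Finset E,
          (t : Set E) ⊆ Subfield.closure (Set.range (algebraMap S E) ∪ (s₀ : Set E)) ∧
          (s₀ : Set E) ⊆ Subfield.closure (Set.range (algebraMap S E) ∪ (t : Set E)) ∧
          ∃ hTO : (Algebra.adjoin S (t : Set E)).toSubring ≤ OE.toSubring,
            IsRegularLocalRing (Localization.AtPrime
              (Ideal.comap (Subring.inclusion hTO) (maximalIdeal OE)))) →
    ∀ (OE : ValuationSubring E), (∀ s : S, algebraMap S E s ∈ OE) →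
      (∀ s ∈ maximalIdeal S, OE.valuation (algebraMap S E s) < 1) →
      (∀ y : OE, ∃ q : S[X], (∃ i, q.coeff i ∉ maximalIdeal S) ∧
        OE.valuation (q.eval₂ (algebraMap S E) y) < 1) →
      ∀ s₀ : Finset E, ∃ t : Finset E,
          (t : Set E) ⊆ Subfield.closure (Set.range (algebraMap S E) ∪ (s₀ : Set E)) ∧
          (s₀ : Set E) ⊆ Subfield.closure (Set.range (algebraMap S E) ∪ (t : Set E)) ∧
          ∃ hTO : (Algebra.adjoin S (t : Set E)).toSubring ≤ OE.toSubring,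
            IsRegularLocalRing (Localization.AtPrime
              (Ideal.comap (Subring.inclusion hTO) (maximalIdeal OE))) := by
  intro p _ S _ _ hS hSdim _ _ E _ _ hinj _ halg hrank OE hSO hdom hres s₀
  classical
  by_cases hr : Nonempty OE.valuation.RankOne
  · exact hrank OE hr hSO hdom hres s₀
  haveI : IsDomain S := isDomain_of_isRegularLocalRing S
  haveI : IsNoetherianRing S := hS.isUniversallyCatenaryRing.1
  haveI := halg
  -- `𝔪_S ≠ 0`, so `O_E ≠ E`
  obtain ⟨s, hsm, hs0⟩ : ∃ s ∈ maximalIdeal S, s ≠ 0 := by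
    by_contra h
    push Not at h
    have h0 : maximalIdeal S = ⊥ := le_bot_iff.mp fun s hs => (Submodule.mem_bot S).mpr (h s hs)
    have hfield : IsField S := IsLocalRing.isField_iff_maximalIdeal_eq.mpr h0
    have hdim0 := ringKrullDim_eq_zero_of_isField hfield
    rw [hSdim] at hdim0
    exact absurd hdim0 (by decide)
  have hOEtop : OE ≠ ⊤ := by
    intro htop
    have ha0 : algebraMap S E s ≠ 0 := fun h => hs0 (hinj (by rw [h, map_zero]))
    have h1 : OE.valuation (algebraMap S E s) < 1 := hdom s hsm
    have h2 : (algebraMap S E s)⁻¹ ∈ OE := by rw [htop]; exact ValuationSubring.mem_top _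
    have h3 := (OE.valuation_le_one_iff _).mpr h2
    rw [map_inv₀, inv_le_one₀ ((Valuation.pos_iff _).mpr ha0)] at h3
    exact not_lt.mpr h3 h1
  -- a valuation ring strictly between `O_E` and `E`
  obtain ⟨O₁', hle', hne', htop'⟩ : ∃ O₁' : ValuationSubring E, OE ≤ O₁' ∧ O₁' ≠ OE ∧ O₁' ≠ ⊤ := by
    by_contra h
    push Not at h
    refine hr (nonempty_rankOne_of_overrings OE hOEtop fun T hT => ?_)
    by_cases hT' : T = OE
    · exact Or.inl hT'
    · exact Or.inr (h T hT hT')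
  -- the level field `K = F(s₀)` as a type
  let M : Subfield E := Subfield.closure (Set.range (algebraMap S E) ∪ (s₀ : Set E))
  have hSM : ∀ s : S, algebraMap S E s ∈ M := fun s => Subfield.subset_closure (Or.inl ⟨s, rfl⟩)
  have hs₀M : ∀ z ∈ s₀, z ∈ M := fun z hz => Subfield.subset_closure (Or.inr hz)
  let K : Type u := M
  letI : Algebra S K := ((algebraMap S E).codRestrict M hSM).toAlgebra
  haveI : IsScalarTower S K E := IsScalarTower.of_algebraMap_eq fun _ => rfl
  haveI : FaithfulSMul S K := (faithfulSMul_iff_algebraMap_injective S K).mpr fun a b hab =>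
    hinj (by
      have h := congrArg (fun z : K => (z : E)) hab
      exact h)
  haveI : Algebra.IsAlgebraic S K :=
    Algebra.IsAlgebraic.of_injective (IsScalarTower.toAlgHom S K E) Subtype.val_injective
  haveI : Algebra.IsAlgebraic K E :=
    Algebra.IsAlgebraic.extendScalars (R := S) (FaithfulSMul.algebraMap_injective S K)
  -- the two valuation rings restricted to `K`
  let O : ValuationSubring K := OE.comap (algebraMap K E)
  let O₁ : ValuationSubring K := O₁'.comap (algebraMap K E)
  have hO : O ≤ O₁ := fun z hz => hle' hz
  have hvalK : ∀ z : K, O.valuation z < 1 ↔ OE.valuation (z : E) < 1 := fun z =>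
    valuation_comap_lt_one_iff OE (algebraMap K E) z
  have hne : O ≠ O₁ := fun h => hne' (ValuationSubring.eq_of_le_of_comap_eq (F := K) hle' h).symm
  have hO₁top : O₁ ≠ ⊤ := by
    intro htop
    have hKO₁' : ∀ z : K, (z : E) ∈ O₁' := fun z => by
      have hz : z ∈ O₁ := by rw [htop]; exact ValuationSubring.mem_top z
      exact hz
    apply htop'
    ext w
    simp only [ValuationSubring.mem_top, iff_true]
    have hint : IsIntegral K w := (Algebra.IsAlgebraic.isAlgebraic (R := K) w).isIntegral
    let Ov : Subring E := O₁'.valuation.integer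
    have hOv : ∀ z, z ∈ Ov ↔ z ∈ O₁' := fun z => by
      rw [Valuation.mem_integer_iff, O₁'.valuation_le_one_iff]
    letI : Algebra K Ov :=
      ((algebraMap K E).codRestrict Ov (fun z => (hOv _).mpr (hKO₁' z))).toAlgebra
    haveI : IsScalarTower K Ov E := IsScalarTower.of_algebraMap_eq fun _ => rfl
    have hint' : IsIntegral Ov w := hint.tower_top
    exact (hOv w).mp ((Valuation.integer.integers O₁'.valuation).mem_of_integral hint')
  have hSO_K : ∀ s : S, algebraMap S K s ∈ O := fun s => by
    change algebraMap S E s ∈ OE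
    exact hSO s
  have hdomK : ∀ s ∈ maximalIdeal S, O.valuation (algebraMap S K s) < 1 := fun s hs =>
    (hvalK _).mpr (hdom s hs)
  have hresK : ∀ y : O, ∃ q : S[X], (∃ i, q.coeff i ∉ maximalIdeal S) ∧
      O.valuation (q.eval₂ (algebraMap S K) y) < 1 := fun y => by
    obtain ⟨q, hq, hv⟩ := hres ⟨((y : K) : E), y.2⟩
    refine ⟨q, hq, ?_⟩
    rw [hvalK]
    have h : (((q.eval₂ (algebraMap S K) (y : K)) : K) : E) =
        q.eval₂ (algebraMap S E) ((y : K) : E) := by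
      change algebraMap K E (q.eval₂ (algebraMap S K) (y : K)) = _
      rw [Polynomial.hom_eval₂, ← IsScalarTower.algebraMap_eq]
      rfl
    rw [h]
    exact hv
  -- a first model `R = S[g(s₀)] ⊆ O` with `Frac R = K`
  let g : K → K := fun z => if z ∈ O then z else z⁻¹
  have hg : ∀ z, g z ∈ O := by
    intro z
    by_cases hz : z ∈ O
    · simp only [g, hz, if_true]
    · simp only [g, hz, if_false]; exact (O.mem_or_inv_mem z).resolve_left hz
  let s₀K : Finset K := s₀.attach.image fun z => g ⟨z.1, hs₀M z.1 z.2⟩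
  let R : Subalgebra S K := Algebra.adjoin S (s₀K : Set K)
  have hRO : R.toSubring ≤ O.toSubring := by
    have : R ≤ ({ O.toSubring with algebraMap_mem' := hSO_K } : Subalgebra S K) := by
      refine Algebra.adjoin_le ?_
      intro z hz
      obtain ⟨w, -, rfl⟩ := Finset.mem_image.mp (Finset.mem_coe.mp hz)
      exact hg _
    exact fun z hz => this hz
  have hRfg : R.FG := Subalgebra.fg_adjoin_finset _
  have hgen : ∀ z : K, z ∈ Subfield.closure (R : Set K) := by
    intro z
    have hle : M ≤ (Subfield.closure (R : Set K)).map (algebraMap K E) := by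
      refine Subfield.closure_le.mpr ?_
      rintro w (⟨s, rfl⟩ | hw)
      · exact ⟨algebraMap S K s, Subfield.subset_closure (R.algebraMap_mem s), rfl⟩
      · let wK : K := ⟨w, hs₀M w hw⟩
        have hgw : g wK ∈ R := Algebra.subset_adjoin (by
          rw [Finset.mem_coe]
          exact Finset.mem_image.mpr ⟨⟨w, hw⟩, Finset.mem_attach _ _, rfl⟩)
        refine ⟨wK, ?_, rfl⟩
        by_cases hwO : wK ∈ O
        · have h1 : g wK = wK := if_pos hwO
          rw [← h1]; exact Subfield.subset_closure hgw
        · have h1 : g wK = wK⁻¹ := if_neg hwO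
          have hinv : wK⁻¹ ∈ Subfield.closure (R : Set K) := by
            rw [← h1]; exact Subfield.subset_closure hgw
          have h2 := Subfield.inv_mem _ hinv
          rwa [inv_inv] at h2
    obtain ⟨z', hz', hzz'⟩ := hle z.2
    have h : z' = z := Subtype.ext hzz'
    rw [← h]; exact hz'
  haveI hRfrac : IsFractionRing R K := by
    refine IsFractionRing.of_field R K fun z => ?_
    obtain ⟨a, ha, b, hb, hab⟩ := Subfield.mem_closure_iff.mp (hgen z)
    have hcl : Subring.closure (R : Set K) = R.toSubring := Subring.closure_eq R.toSubring
    rw [hcl] at ha hb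
    exact ⟨⟨a, ha⟩, ⟨b, hb⟩, hab.symm⟩
  -- the regular model at the level `K`
  obtain ⟨A₃, hA₃, hRA₃, hA₃fg, hreg₃⟩ := exists_model_regular_of_lt_of_cjs hCJS hS hSdim O O₁ hO hne
    hO₁top hSO_K hdomK hresK R hRfg hRO
  -- back to `E`
  obtain ⟨g₃, hg₃⟩ := hA₃fg
  let valₐ : K →ₐ[S] E := IsScalarTower.toAlgHom S K E
  let t : Finset E := g₃.image (fun z : K => (z : E))
  have hA₃map : (A₃.map valₐ : Subalgebra S E) = Algebra.adjoin S (t : Set E) := by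
    rw [← hg₃, AlgHom.map_adjoin, Finset.coe_image]
    rfl
  haveI : IsFractionRing A₃ K := isFractionRing_subalgebra_of_le R A₃ hRA₃
  have hsub : ∀ w : E, w ∈ Algebra.adjoin S (t : Set E) →
      w ∈ Subfield.closure (Set.range (algebraMap S E) ∪ (t : Set E)) := by
    intro w hw
    have hw' : w ∈ (Algebra.adjoin S (t : Set E)).toSubring := hw
    rw [Algebra.adjoin_eq_ring_closure] at hw'
    exact (Subring.closure_le (t := (Subfield.closure
      (Set.range (algebraMap S E) ∪ (t : Set E))).toSubring)).mpr
      (fun u hu => Subfield.subset_closure hu) hw'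
  have hmapO : (A₃.map valₐ).toSubring ≤ OE.toSubring := by
    intro z hz
    obtain ⟨w, hw, rfl⟩ := Subalgebra.mem_map.mp hz
    exact hA₃ hw
  have hTO : (Algebra.adjoin S (t : Set E)).toSubring ≤ OE.toSubring := by
    rw [← hA₃map]; exact hmapO
  refine ⟨t, ?_, ?_, hTO, ?_⟩
  · intro z hz
    obtain ⟨w, -, rfl⟩ := Finset.mem_image.mp (Finset.mem_coe.mp hz)
    exact w.2
  · intro z hz
    let zK : K := ⟨z, hs₀M z hz⟩
    obtain ⟨a, b, -, hab⟩ := IsFractionRing.div_surjective (A := A₃) zK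
    have ha : ((a : K) : E) ∈ Algebra.adjoin S (t : Set E) := by
      rw [← hA₃map]; exact Subalgebra.mem_map.mpr ⟨a, a.2, rfl⟩
    have hb : ((b : K) : E) ∈ Algebra.adjoin S (t : Set E) := by
      rw [← hA₃map]; exact Subalgebra.mem_map.mpr ⟨b, b.2, rfl⟩
    have hz' : z = ((a : K) : E) / ((b : K) : E) := by
      have h := congrArg Subtype.val hab
      rw [Subfield.coe_div] at h
      exact h.symm
    rw [hz']
    exact div_mem (hsub _ ha) (hsub _ hb)
  · let P₃ : Ideal A₃ := (maximalIdeal O).comap (Subring.inclusion hA₃)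
    haveI : P₃.IsPrime := Ideal.IsPrime.comap _
    have hP₃ : ∀ z : A₃, z ∈ P₃ ↔ OE.valuation (valₐ z) < 1 := fun z => by
      rw [Ideal.mem_comap, ValuationSubring.valuation_lt_one_iff]
      exact hvalK z
    let Q₃ : Ideal (A₃.map valₐ) := (maximalIdeal OE).comap (Subring.inclusion hmapO)
    haveI : Q₃.IsPrime := Ideal.IsPrime.comap _
    have hQ₃ : ∀ z : A₃.map valₐ, z ∈ Q₃ ↔ OE.valuation (z : E) < 1 := fun z => by
      rw [Ideal.mem_comap, ValuationSubring.valuation_lt_one_iff]; rfl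
    have hregQ₃ : IsRegularLocalRing (Localization.AtPrime Q₃) :=
      (isRegularLocalRing_localization_map_iff valₐ OE A₃ P₃ hP₃ Q₃ hQ₃).mp hreg₃
    let PT : Ideal (Algebra.adjoin S (t : Set E)) := (maximalIdeal OE).comap (Subring.inclusion hTO)
    haveI : PT.IsPrime := Ideal.IsPrime.comap _
    have hPT : ∀ z : Algebra.adjoin S (t : Set E), z ∈ PT ↔ OE.valuation (z : E) < 1 := fun z => by
      rw [Ideal.mem_comap, ValuationSubring.valuation_lt_one_iff]; rfl
    exact (isRegularLocalRing_localization_iff_of_subalgebra_eq OE hA₃map Q₃ hQ₃ PT hPT).mp hregQ₃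

end Literature.AlgebraicGeometry.Resolution

end
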